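import Summits.Ventures.HSemireg.WedgeHankelOuterFamily
import Summits.Ventures.HSemireg.WedgeKernelDuality

/-!
# Venture HSemireg — THE KERNEL OF A CLASS IS A FUNCTION OF THE COLUMN SPACE OF ITS CATALECTICANT: for two classes `w_N(q)`, `w_N(q′)` of one box and any degree `k`,
# **`col H_k(q) ⊆ col H_k(q′) ⇒ Kr(univ, w_N q′, k) ⊆ Kr(univ, w_N q, k)`** (every field, every `N`, `k`; no hypothesis) — hence equal column spaces give equal kernels, and dually
# (E1) `V(univ, w_N q, k′) ⊆ V(univ, w_N q′, k′)` in the mirror degree; the proof is the JOINT KERNEL LAW for the pair `{q, q′}`: its block Hankel rank is `rank H_k(q′)`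

HONEST FRAMING. Part of the Lean index of the computation cell `pub-hsemireg` (seat p10 gen 24, Sunday typer «UNIFORM-IN-n»).
Finite-dimensional EXTERIOR ALGEBRA over a field + ranks of block matrices ONLY: no variety, no cohomology theory, no sheaf, no Ext group, no semiregularity map;
nothing here says that HC / HC_CM / HC_AV holds; no Literature fact is declared or used.  Custodian versions as in `WedgeHankelSiegelIdeal` (1/3) and `WedgeKernelDuality` (E1); the
dictionary (`H_k(q)` = the catalecticant of `v = Σ q_j Θ^j/j!`; `col H_k(q) ⊆ K^{k+1}`) is QUOTED, never asserted.

WHAT IS IN THE TREE.  J1 (`WedgeHankelOuterFamily`): **`finrank_iInf_Kr_w_top_add`** (`dim (Hom(univ,k) ⊓ ⋂_c Kr(univ, w_N q_c, k)) + C(N,k)·rank [H_k(q_c)]_c = C(2N,k)`); E1 (`WedgeKernelDuality`):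
`Kr_univ_eq_of_V_eq` / `Kr_univ_mono_of_V_le` (the kernel is determined by the MIRROR IMAGE), `V_w_eq_Ann`, `Ann_anti`; th-7's `hank`, `hankel1`; Mathlib `Matrix.range_mulVecLin`,
`LinearMap.funLeft`.
THIS FILE (namespace `Summit.Ventures.HSemireg.Wedge.HankelOuter` continued; imports J1 and E1):
* §425 THE BLOCK RANK IS THE DIMENSION OF THE SUM OF THE COLUMN SPACES: `hank_col_eq_funLeft` (a column of `[H_k(q_c)]_c` is a column of some `H_k(q_c)`, re-indexed),
  `span_range_hank_col_eq_map_iSup`, **`rank_hank_eq_finrank_iSup_range`** (`rank [H_k(q_c)]_c = dim (Σ_c col H_k(q_c))`), `rank_hank_eq_rank_of_forall_range_le` (a family dominated by one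
  member `c₀`: block rank `= rank H_k(q_{c₀})`).
* §426 **`Hom_iInf_Kr_w_eq_Kr_of_forall_range_le`** (a dominated family's joint kernel IS the dominant class's kernel), **`Kr_w_anti_of_range_hankel1_le`**
  (`col H_k(q) ⊆ col H_k(q′) ⇒ Kr(w_N q′, k) ⊆ Kr(w_N q, k)`), **`Kr_w_eq_of_range_hankel1_eq`** (equal column spaces ⇒ equal kernels), and the image side
  **`V_w_mono_of_range_hankel1_le`** / `V_w_eq_of_range_hankel1_eq` (`k + k′ = N`: `V(univ, w_N q, k′) ⊆ V(univ, w_N q′, k′)`).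
READING: THEOREM H says the kernel's SIZE is a function of `rank H_k(q)`; this says the kernel ITSELF is a function of the column space `col H_k(q) ⊆ K^{k+1}`, antitone — the atlas's
named kernels (frames `F_λ`, node kernels `SI_k ⊔ Φs λ(xRich)`, two-node kernels …) are the values of that function on lines, osculating flags, … of the rational normal curve.  Nothing
Ext-side.  New names only.
-/

open Module

namespace Summit.Ventures.HSemireg.Wedge.HankelOuter

open Summit.Ventures.HSemireg.Wedge Summit.Ventures.HSemireg.Wedge.Kunneth Summit.Ventures.HSemireg.Wedge.Hankel
  Summit.Ventures.HSemireg.Wedge.BasisFree Summit.Ventures.HSemireg.Wedge.HankelSiegel Summit.Ventures.HSemireg.Wedge.HankelSiegelIdeal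
  Summit.Ventures.HSemireg.Wedge.KunnethKernel Summit.Ventures.HSemireg.Wedge.HankelFrameChange Summit.Ventures.HSemireg.Wedge.KernelDuality

variable (K : Type*) [Field K] {N : ℕ} {ι : Type} [Fintype ι] [DecidableEq ι]

/-! ## §425. The block Hankel rank is the dimension of the sum of the column spaces -/

omit [Fintype ι] [DecidableEq ι] in
/-- a column `(c, t)` of the block matrix `[H_k(q_c)]_c` is the column `t` of `H_k(q_c)`, re-indexed along `Unit × Fin (k+1) → Fin (k+1)`. -/
theorem hank_col_eq_funLeft (k : ℕ) (q : ι → ℕ → K) (c : ι) (t : Fin (N + 1 - k)) :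
    (hank K N k (fun (_ : Unit) (c : ι) => q c)).col (c, t) = LinearMap.funLeft K K (Prod.snd : Unit × Fin (k + 1) → Fin (k + 1)) ((hankel1 K N k (q c)).col t) := by
  funext ⟨u, i⟩
  rw [Matrix.col_apply, LinearMap.funLeft_apply, Matrix.col_apply]
  simp only [hank, hank', hankel1, Matrix.of_apply]

omit [Fintype ι] [DecidableEq ι] in
/-- the column space of the block matrix is the (re-indexed) SUM of the column spaces of the blocks. -/
theorem span_range_hank_col_eq_map_iSup (k : ℕ) (q : ι → ℕ → K) :
    Submodule.span K (Set.range (hank K N k (fun (_ : Unit) (c : ι) => q c)).col)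
      = (⨆ c, LinearMap.range (hankel1 K N k (q c)).mulVecLin).map (LinearMap.funLeft K K (Prod.snd : Unit × Fin (k + 1) → Fin (k + 1))) := by
  refine le_antisymm ?_ ?_
  · rw [Submodule.span_le]
    rintro _ ⟨⟨c, t⟩, rfl⟩
    rw [hank_col_eq_funLeft]
    refine Submodule.mem_map_of_mem (Submodule.mem_iSup_of_mem c ?_)
    rw [Matrix.range_mulVecLin]
    exact Submodule.subset_span ⟨t, rfl⟩
  · rw [Submodule.map_le_iff_le_comap]
    refine iSup_le fun c => ?_
    rw [Matrix.range_mulVecLin, Submodule.span_le]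
    rintro _ ⟨t, rfl⟩
    rw [SetLike.mem_coe, Submodule.mem_comap, ← hank_col_eq_funLeft]
    exact Submodule.subset_span ⟨(c, t), rfl⟩

omit [DecidableEq ι] in
/-- **THE BLOCK HANKEL RANK IS THE DIMENSION OF THE SUM OF THE COLUMN SPACES: `rank [H_k(q_c)]_c = dim (Σ_c col H_k(q_c))`** (every finite family, every field). -/
theorem rank_hank_eq_finrank_iSup_range (k : ℕ) (q : ι → ℕ → K) :
    (hank K N k (fun (_ : Unit) (c : ι) => q c)).rank = finrank K ↥(⨆ c, LinearMap.range (hankel1 K N k (q c)).mulVecLin) := by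
  rw [Matrix.rank_eq_finrank_span_cols, span_range_hank_col_eq_map_iSup]
  exact ((Submodule.equivMapOfInjective _ (LinearMap.funLeft_injective_of_surjective K K _ Prod.snd_surjective) _).finrank_eq).symm

omit [DecidableEq ι] in
/-- a family DOMINATED by one member: if every `col H_k(q_c) ⊆ col H_k(q_{c₀})` then **`rank [H_k(q_c)]_c = rank H_k(q_{c₀})`.** -/
theorem rank_hank_eq_rank_of_forall_range_le (k : ℕ) (q : ι → ℕ → K) (c₀ : ι)
    (h : ∀ c, LinearMap.range (hankel1 K N k (q c)).mulVecLin ≤ LinearMap.range (hankel1 K N k (q c₀)).mulVecLin) :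
    (hank K N k (fun (_ : Unit) (c : ι) => q c)).rank = (hankel1 K N k (q c₀)).rank := by
  have e : (⨆ c, LinearMap.range (hankel1 K N k (q c)).mulVecLin) = LinearMap.range (hankel1 K N k (q c₀)).mulVecLin :=
    le_antisymm (iSup_le h) (le_iSup (fun c => LinearMap.range (hankel1 K N k (q c)).mulVecLin) c₀)
  rw [rank_hank_eq_finrank_iSup_range, e, Matrix.rank]

/-! ## §426. The kernel is a function of the column space -/

/-- **A DOMINATED FAMILY'S JOINT KERNEL IS THE DOMINANT KERNEL: `col H_k(q_c) ⊆ col H_k(q_{c₀})` for all `c` ⇒ `Hom(univ,k) ⊓ ⋂_c Kr(univ, w_N q_c, k) = Kr(univ, w_N q_{c₀}, k)`** (the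
joint kernel law for the family and for `{q_{c₀}}` give the same dimension). -/
theorem Hom_iInf_Kr_w_eq_Kr_of_forall_range_le (k : ℕ) (q : ι → ℕ → K) (c₀ : ι)
    (h : ∀ c, LinearMap.range (hankel1 K N k (q c)).mulVecLin ≤ LinearMap.range (hankel1 K N k (q c₀)).mulVecLin) :
    Hom K (In N) (Finset.univ : Finset (In N)) k ⊓ (⨅ c, Kr K (Finset.univ : Finset (In N)) (w K N N (q c)) k) = Kr K (Finset.univ : Finset (In N)) (w K N N (q c₀)) k := by
  have hle : Hom K (In N) (Finset.univ : Finset (In N)) k ⊓ (⨅ c, Kr K (Finset.univ : Finset (In N)) (w K N N (q c)) k) ≤ Kr K (Finset.univ : Finset (In N)) (w K N N (q c₀)) k :=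
    le_trans inf_le_right (iInf_le _ c₀)
  refine Submodule.eq_of_le_of_finrank_eq hle ?_
  have h1 := finrank_iInf_Kr_w_top_add K (N := N) k q
  have h2 := finrank_iInf_Kr_w_top_add K (N := N) k (fun (_ : Unit) => q c₀)
  have e2 : Hom K (In N) (Finset.univ : Finset (In N)) k ⊓ (⨅ _ : Unit, Kr K (Finset.univ : Finset (In N)) (w K N N (q c₀)) k) = Kr K (Finset.univ : Finset (In N)) (w K N N (q c₀)) k := by
    rw [iInf_const]
    exact inf_eq_right.mpr (Kr_le_Hom K _ _ _)
  rw [e2, rank_hank_eq_rank_of_forall_range_le K k (fun (_ : Unit) => q c₀) () (fun _ => le_rfl)] at h2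
  rw [rank_hank_eq_rank_of_forall_range_le K k q c₀ h] at h1
  omega

/-- **THE KERNEL IS ANTITONE IN THE COLUMN SPACE OF THE CATALECTICANT: `col H_k(q) ⊆ col H_k(q′) ⇒ Kr(univ, w_N q′, k) ⊆ Kr(univ, w_N q, k)`** (every field, `N`, `k`, `q`, `q′`). -/
theorem Kr_w_anti_of_range_hankel1_le (k : ℕ) {q q' : ℕ → K} (h : LinearMap.range (hankel1 K N k q).mulVecLin ≤ LinearMap.range (hankel1 K N k q').mulVecLin) :
    Kr K (Finset.univ : Finset (In N)) (w K N N q') k ≤ Kr K (Finset.univ : Finset (In N)) (w K N N q) k := by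
  have hcond : ∀ b : Bool, LinearMap.range (hankel1 K N k ((fun b : Bool => if b then q' else q) b)).mulVecLin
      ≤ LinearMap.range (hankel1 K N k ((fun b : Bool => if b then q' else q) true)).mulVecLin := by
    intro b
    cases b
    · simpa only [Bool.false_eq_true, if_false, if_true] using h
    · exact le_rfl
  have hfam := Hom_iInf_Kr_w_eq_Kr_of_forall_range_le K (N := N) k (fun b : Bool => if b then q' else q) true hcond
  simp only [if_true] at hfam
  rw [← hfam]
  exact le_trans inf_le_right (le_of_eq_of_le rfl (iInf_le (fun b : Bool => Kr K (Finset.univ : Finset (In N)) (w K N N (if b then q' else q)) k) false))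

/-- **EQUAL COLUMN SPACES ⇒ EQUAL KERNELS: `col H_k(q) = col H_k(q′) ⇒ Kr(univ, w_N q, k) = Kr(univ, w_N q′, k)`** — the degree-`k` kernel of a class is a function of the subspace
`col H_k(q) ⊆ K^{k+1}`. -/
theorem Kr_w_eq_of_range_hankel1_eq (k : ℕ) {q q' : ℕ → K} (h : LinearMap.range (hankel1 K N k q).mulVecLin = LinearMap.range (hankel1 K N k q').mulVecLin) :
    Kr K (Finset.univ : Finset (In N)) (w K N N q) k = Kr K (Finset.univ : Finset (In N)) (w K N N q') k :=
  le_antisymm (Kr_w_anti_of_range_hankel1_le K k h.ge) (Kr_w_anti_of_range_hankel1_le K k h.le)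

/-- the image side (E1's duality): **`col H_k(q) ⊆ col H_k(q′) ⇒ V(univ, w_N q, k′) ⊆ V(univ, w_N q′, k′)`** for `k + k′ = N`. -/
theorem V_w_mono_of_range_hankel1_le {k k' : ℕ} (hkk' : k + k' = N) {q q' : ℕ → K}
    (h : LinearMap.range (hankel1 K N k q).mulVecLin ≤ LinearMap.range (hankel1 K N k q').mulVecLin) :
    V K (In N) Finset.univ (w K N N q) k' ≤ V K (In N) Finset.univ (w K N N q') k' := by
  rw [V_w_eq_Ann K hkk' q, V_w_eq_Ann K hkk' q']
  exact Ann_anti K _ (Kr_w_anti_of_range_hankel1_le K k h)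

/-- **equal column spaces ⇒ equal images in the mirror degree** (`k + k′ = N`). -/
theorem V_w_eq_of_range_hankel1_eq {k k' : ℕ} (hkk' : k + k' = N) {q q' : ℕ → K}
    (h : LinearMap.range (hankel1 K N k q).mulVecLin = LinearMap.range (hankel1 K N k q').mulVecLin) :
    V K (In N) Finset.univ (w K N N q) k' = V K (In N) Finset.univ (w K N N q') k' :=
  le_antisymm (V_w_mono_of_range_hankel1_le K hkk' h.le) (V_w_mono_of_range_hankel1_le K hkk' h.ge)

end Summit.Ventures.HSemireg.Wedge.HankelOuter
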